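import Mathlib
import HarnessLib
import Summits.Ventures.LatticeQCDFlow.Scaling.GeometricProtocol
import Summits.Ventures.LatticeQCDFlow.Scaling.PerfectRelaxationTelescoping
import Summits.Ventures.LatticeQCDFlow.Scaling.VarianceFloorLayerLaw
import Summits.Ventures.LatticeQCDFlow.TrivializingMaps.ReweightingStepLaw

/-!
HONEST FRAMING: exact (Metropolis-corrected) sampling algorithms for lattice gauge theory; figures
of merit are autocorrelation/cost numbers at stated couplings and volumes; no continuum-physics
claim.

# SpecificHeatProtocolLaw — THE THREE-POINT INEQUALITY OF A FREE ENERGY WITH A SPECIFIC-HEAT FLOOR: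
# `protocolCost F b ≥ K·log²R/(n + log R)` FOR EVERY PROTOCOL, EQUALITY FOR THE SCALE FAMILY
# (theory2 GEN-38, item 125 PART 1 of 2, OURS; custody landing lean-2 GEN-9 per LEAD LINE 245 —
# statements and proofs = HOME/lean/theory2/SpecificHeatFloorLog2Law.lean dc3e6ab7381136de §1–§2,
# split at `end Protocol` as HOME/lean/theory2/LANDING.md §36 prescribes; header trimmed)

Venture `LatticeQCDFlow` (cell pub-lqcd), topic `Scaling`, FANOUT row 29 (THEORY-2.md v5.2 §3.5 (ix-c) /
§4 rows C6, C6-SH).  Elementary real analysis + bookkeeping over tree objects; nothing is cited as a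
fact; no `sorry`, no new axiom.

Write `F` for a "free energy" `β ↦ log Z(β)` and, for a protocol `b₀ ≤ b₁ ≤ … ≤ b_n`,
`protocolCost F b := Σ_{j<n} [F(b_j) + F(2b_{j+1} − b_j) − 2F(b_{j+1})]`.  In the two settings docked
in PART 2 (`SpecificHeatFloorLog2Law`) this is EXACTLY the log of the product of the second moments of the
one-step importance weights, i.e. the cost of PERFECTLY RELAXED annealing / sequential reweighting along `b`.

* §1–§2 (abstract, sharp).  If `β ↦ F(β) + K·log β` is CONVEX on `[β₀, ∞)` ("specific-heat floor":
  for `C²` `F` this is `F″(β) = Var_β ≥ K/β²`), then for EVERY protocol in `[β₀, ∞)` with `n ≥ 1`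
  layers and total ratio `R = b_n/b_0`, `U = log R`:
  **`protocolCost F b ≥ K·Σ_j f(log(b_{j+1}/b_j)) ≥ K·U²/(n + U)`** (`f = layerCost`, the tree's
  `2u − log(2e^u − 1)`), hence **`n ≥ K·log²R/t − log R`** layers are NECESSARY for cost `≤ t`
  (`protocolCost_ge_sq_div`, `layers_necessary`).  The three-point inequality is an EQUALITY for the
  scale family `F = −K log β + affine` (`protocolCost_neg_mul_log`), so the constant is sharp.
  Conversely, if `F + K'·log` is CONCAVE on `[β₀, ∞)` ("specific-heat ceiling") then
  `protocolCost F b ≤ K'·Σ_j log²(b_{j+1}/b_j)` and the GEOMETRIC protocol `b_j = β₀e^{jU/n}` has cost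
  `≤ K'·U²/n` (`protocolCost_geomProtocol_le`): `n ≥ K'·log²R/t` layers SUFFICE.
* §2 also gives the PER-STEP WINDOW LAW (`logRatio_le_of_stepCost`): if every step costs `≤ t₀` then
  `log R ≤ n·(t₀/K + √(t₀/K))`, i.e. **`n ≥ ½√(K/t₀)·log R`** steps for `t₀ ≤ K` — with `K = c·V` the
  printed `√V` replica/window-count law (Nymeyer–Gnanakaran–García 2004, Methods Enzymol. 383, eqs.
  (10)–(12)) with its `log R` dependence explicit, as a theorem under a one-sided convexity hypothesis.

NEAREST PRINTED FORM of the total-cost law: the step-equilibration theorem of Nulton–Salamon–Andresen–Anmin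
(J. Chem. Phys. 83 (1985) 334): an `N`-step process that equilibrates fully after each step dissipates
`≥ L²/(2N)` to LEADING ORDER in the step size, `L` the thermodynamic length.  What this file adds: an EXACT
inequality for all step sizes (the `n + log R` denominator is the price: `f(u) ≥ u²/(1+u)` replaces the
quadratic expansion), a ONE-SIDED hypothesis (floor ⟹ convexity of `F + K log`), the kernel-checked proof.
-/

noncomputable section

namespace Summit.Ventures.LatticeQCDFlow.Theory2.SpecificHeat

open Finset Set Real

/-! ## §1. Model calculus: `f(log(y/x))` as a three-point expression; `u²/(1+u) ≤ f(u)` -/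

/-- **`f(log(y/x)) = 2 log y − log x − log(2y − x)`** for `0 < x ≤ y` (`f = layerCost`): the cost of
one layer of log-ratio `u = log(y/x)` in the scale model is the second difference of `−log` at the three
points `x, y, 2y − x`. [ours] -/
theorem layerCost_log_div {x y : ℝ} (hx : 0 < x) (hxy : x ≤ y) :
    layerCost (Real.log (y / x)) = 2 * Real.log y - Real.log x - Real.log (2 * y - x) := by
  have hy : 0 < y := lt_of_lt_of_le hx hxy
  have hz : 0 < 2 * y - x := by linarith
  have h1 : 2 * (y / x) - 1 = (2 * y - x) / x := by
    field_simp
  unfold layerCost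
  rw [Real.exp_log (div_pos hy hx), Real.log_div hy.ne' hx.ne', h1, Real.log_div hz.ne' hx.ne']
  ring

/-- `(1+u)² ≤ 2e^u − 1` for `u ≥ 0` (from `1 + u + u²/2 ≤ e^u`).  [re-proved from HOME item 124 §1 so
that this file depends on the tree only; folklore] -/
theorem one_add_sq_le_two_mul_exp_sub_one {u : ℝ} (hu : 0 ≤ u) : (1 + u) ^ 2 ≤ 2 * Real.exp u - 1 := by
  nlinarith [Real.quadratic_le_exp_of_nonneg hu]

/-- The derivative of `u ↦ u²/(1+u)` at `u ≥ 0` is `(u² + 2u)/(1+u)²`. [folklore] -/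
theorem hasDerivAt_sq_div_one_add {u : ℝ} (hu : 0 ≤ u) :
    HasDerivAt (fun x : ℝ => x ^ 2 / (1 + x)) ((u ^ 2 + 2 * u) / (1 + u) ^ 2) u := by
  have h1 : HasDerivAt (fun x : ℝ => x ^ 2) (2 * u) u := by simpa using hasDerivAt_pow 2 u
  have h2 : HasDerivAt (fun x : ℝ => 1 + x) 1 u := by simpa using (hasDerivAt_id u).const_add 1
  have hne : (1 + u) ≠ 0 := by positivity
  refine (h1.div h2 hne).congr_deriv ?_
  ring

/-- The derivative of `f(u) − u²/(1+u)` is non-negative on `u ≥ 0`: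
`1 − 1/(2e^u − 1) − (u² + 2u)/(1+u)² = 1/(1+u)² − 1/(2e^u − 1) ≥ 0`. [folklore] -/
theorem deriv_layerCost_sub_sq_div_nonneg {u : ℝ} (hu : 0 ≤ u) :
    0 ≤ (1 - 1 / (2 * Real.exp u - 1)) - (u ^ 2 + 2 * u) / (1 + u) ^ 2 := by
  have hpos : 0 < (1 + u) ^ 2 := by positivity
  have h1 : (1 + u) ^ 2 ≤ 2 * Real.exp u - 1 := one_add_sq_le_two_mul_exp_sub_one hu
  have h2 : 1 / (2 * Real.exp u - 1) ≤ 1 / (1 + u) ^ 2 := one_div_le_one_div_of_le hpos h1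
  have h3 : (u ^ 2 + 2 * u) / (1 + u) ^ 2 = 1 - 1 / (1 + u) ^ 2 := by
    field_simp
    ring
  rw [h3]
  linarith

/-- **`u²/(1+u) ≤ f(u)` on `u ≥ 0`** — the lower companion of the tree's `layerCost_le_sq`
(`f(u) ≤ u²`).  [re-proved from HOME item 124 §1; folklore] -/
theorem layerCost_ge_sq_div {u : ℝ} (hu : 0 ≤ u) : u ^ 2 / (1 + u) ≤ layerCost u := by
  have hmono : MonotoneOn (fun u => layerCost u - u ^ 2 / (1 + u)) (Ici 0) := by
    refine monotoneOn_of_deriv_nonneg (convex_Ici 0) ?_ ?_ ?_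
    · exact fun u hu => ((differentiableAt_layerCost hu).continuousAt.sub
        (hasDerivAt_sq_div_one_add hu).differentiableAt.continuousAt).continuousWithinAt
    · intro u hu
      rw [interior_Ici] at hu
      exact ((differentiableAt_layerCost (le_of_lt hu)).sub
        (hasDerivAt_sq_div_one_add (le_of_lt hu)).differentiableAt).differentiableWithinAt
    · intro u hu
      rw [interior_Ici] at hu
      have hu' : 0 ≤ u := le_of_lt hu
      have hd : HasDerivAt (fun u => layerCost u - u ^ 2 / (1 + u))
          ((1 - 1 / (2 * Real.exp u - 1)) - (u ^ 2 + 2 * u) / (1 + u) ^ 2) u :=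
        (hasDerivAt_layerCost (by linarith [one_le_two_mul_exp_sub_one hu'])).sub
          (hasDerivAt_sq_div_one_add hu')
      rw [hd.deriv]
      exact deriv_layerCost_sub_sq_div_nonneg hu'
  have h := hmono (self_mem_Ici) hu hu
  simp only [layerCost_zero] at h
  norm_num at h
  linarith

/-- **Model law, lower half**: for EVERY protocol `u₁, …, u_n ≥ 0` of total `U = Σ u_j`,
`U²/(n + U) ≤ Σ_j f(u_j)` (Jensen, tree `sum_layerCost_ge`, + `layerCost_ge_sq_div`).
[re-proved from HOME item 124 §1; folklore] -/
theorem sum_layerCost_ge_sq_div {n : ℕ} (hn : 0 < n) (u : Fin n → ℝ) (hu : ∀ j, 0 ≤ u j) :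
    (∑ j, u j) ^ 2 / (n + ∑ j, u j) ≤ ∑ j, layerCost (u j) := by
  have hU : 0 ≤ ∑ j, u j := Finset.sum_nonneg fun j _ => hu j
  have hn' : (0 : ℝ) < n := by exact_mod_cast hn
  have hnU : 0 < (n : ℝ) + ∑ j, u j := by linarith
  refine le_trans ?_ (sum_layerCost_ge hn u hu)
  have h := layerCost_ge_sq_div (div_nonneg hU hn'.le)
  calc (∑ j, u j) ^ 2 / (n + ∑ j, u j) = n * (((∑ j, u j) / n) ^ 2 / (1 + (∑ j, u j) / n)) := by
        field_simp
    _ ≤ n * layerCost ((∑ j, u j) / n) := mul_le_mul_of_nonneg_left h hn'.le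

/-! ## §2. The protocol cost functional of a free energy and the three-point inequality -/

section Protocol

variable {n : ℕ}

/-- **Perfect-relaxation cost of a protocol** `b₀, …, b_n` for a free energy `F`: the sum of the second
differences `F(b_j) + F(2b_{j+1} − b_j) − 2F(b_{j+1})`, `j < n` (`= −log Π_j ESS_j` for finite exponential
families, §4; `= Σ_j log E[w_j²]` for smooth actions on `SU(N)^E`, §5). [ours] -/
def protocolCost (F : ℝ → ℝ) (b : Fin (n + 1) → ℝ) : ℝ :=
  ∑ j : Fin n, (F (b j.castSucc) + F (2 * b j.succ - b j.castSucc) - 2 * F (b j.succ))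

/-- The log-ratios of a positive protocol telescope: `Σ_j log(b_{j+1}/b_j) = log(b_n/b_0)`. [folklore] -/
theorem sum_log_ratio_eq (b : Fin (n + 1) → ℝ) (hb : ∀ j, 0 < b j) :
    ∑ j : Fin n, Real.log (b j.succ / b j.castSucc) = Real.log (b (Fin.last n) / b 0) := by
  have h : ∀ j : Fin n, Real.log (b j.succ / b j.castSucc) =
      Real.log (b j.succ) - Real.log (b j.castSucc) := fun j => Real.log_div (hb _).ne' (hb _).ne'
  simp only [h]
  rw [Real.log_div (hb _).ne' (hb _).ne']
  exact sum_steps_eq (fun j => Real.log (b j))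

/-- **THREE-POINT INEQUALITY (floor).**  If `β ↦ F(β) + K log β` is convex on `[β₀, ∞)` (`β₀ > 0`)
then for `β₀ ≤ x ≤ y`: **`K·f(log(y/x)) ≤ F(x) + F(2y − x) − 2F(y)`** — midpoint convexity at `y`
between `x` and `2y − x`; EQUALITY for `F = −K log + affine`. [ours] -/
theorem secondDiff_ge_mul_layerCost {F : ℝ → ℝ} {K β₀ x y : ℝ} (hβ₀ : 0 < β₀)
    (hG : ConvexOn ℝ (Ici β₀) (fun β => F β + K * Real.log β)) (hx : β₀ ≤ x) (hxy : x ≤ y) :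
    K * layerCost (Real.log (y / x)) ≤ F x + F (2 * y - x) - 2 * F y := by
  have hx0 : 0 < x := lt_of_lt_of_le hβ₀ hx
  have hz : β₀ ≤ 2 * y - x := by linarith
  have h := hG.2 (Set.mem_Ici.2 hx) (Set.mem_Ici.2 hz) (by norm_num : (0 : ℝ) ≤ 1 / 2)
    (by norm_num : (0 : ℝ) ≤ 1 / 2) (by norm_num : (1 : ℝ) / 2 + 1 / 2 = 1)
  simp only [smul_eq_mul] at h
  rw [show (1 : ℝ) / 2 * x + 1 / 2 * (2 * y - x) = y by ring] at h
  rw [layerCost_log_div hx0 hxy, show K * (2 * Real.log y - Real.log x - Real.log (2 * y - x)) =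
    2 * (K * Real.log y) - K * Real.log x - K * Real.log (2 * y - x) by ring]
  linarith

/-- **THREE-POINT INEQUALITY (ceiling).**  If `β ↦ F(β) + K log β` is concave on `[β₀, ∞)` then for
`β₀ ≤ x ≤ y`: **`F(x) + F(2y − x) − 2F(y) ≤ K·f(log(y/x))`**. [ours] -/
theorem secondDiff_le_mul_layerCost {F : ℝ → ℝ} {K β₀ x y : ℝ} (hβ₀ : 0 < β₀)
    (hG : ConcaveOn ℝ (Ici β₀) (fun β => F β + K * Real.log β)) (hx : β₀ ≤ x) (hxy : x ≤ y) :
    F x + F (2 * y - x) - 2 * F y ≤ K * layerCost (Real.log (y / x)) := by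
  have hx0 : 0 < x := lt_of_lt_of_le hβ₀ hx
  have hz : β₀ ≤ 2 * y - x := by linarith
  have h := hG.2 (Set.mem_Ici.2 hx) (Set.mem_Ici.2 hz) (by norm_num : (0 : ℝ) ≤ 1 / 2)
    (by norm_num : (0 : ℝ) ≤ 1 / 2) (by norm_num : (1 : ℝ) / 2 + 1 / 2 = 1)
  simp only [smul_eq_mul] at h
  rw [show (1 : ℝ) / 2 * x + 1 / 2 * (2 * y - x) = y by ring] at h
  rw [layerCost_log_div hx0 hxy, show K * (2 * Real.log y - Real.log x - Real.log (2 * y - x)) =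
    2 * (K * Real.log y) - K * Real.log x - K * Real.log (2 * y - x) by ring]
  linarith

/-- **Sharpness**: for the scale family `F(β) = −K log β + aβ + c` the protocol cost is EXACTLY
`K·Σ_j f(log(b_{j+1}/b_j))` (every positive monotone protocol). [ours] -/
theorem protocolCost_neg_mul_log (K a c : ℝ) (b : Fin (n + 1) → ℝ) (h0 : 0 < b 0) (hb : Monotone b) :
    protocolCost (fun β => -K * Real.log β + a * β + c) b =
      K * ∑ j : Fin n, layerCost (Real.log (b j.succ / b j.castSucc)) := by
  rw [protocolCost, Finset.mul_sum]
  refine Finset.sum_congr rfl fun j _ => ?_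
  have hx : 0 < b j.castSucc := lt_of_lt_of_le h0 (hb (Fin.zero_le _))
  have hxy : b j.castSucc ≤ b j.succ := hb (Fin.castSucc_le_succ j)
  rw [layerCost_log_div hx hxy]
  ring

/-- Floor ⟹ **`K·Σ_j f(log(b_{j+1}/b_j)) ≤ protocolCost F b`** for every monotone protocol in
`[β₀, ∞)`. [ours] -/
theorem protocolCost_ge_mul_sum_layerCost {F : ℝ → ℝ} {K β₀ : ℝ} (hβ₀ : 0 < β₀)
    (hG : ConvexOn ℝ (Ici β₀) (fun β => F β + K * Real.log β)) (b : Fin (n + 1) → ℝ)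
    (hb0 : β₀ ≤ b 0) (hb : Monotone b) :
    K * ∑ j : Fin n, layerCost (Real.log (b j.succ / b j.castSucc)) ≤ protocolCost F b := by
  rw [protocolCost, Finset.mul_sum]
  exact Finset.sum_le_sum fun j _ =>
    secondDiff_ge_mul_layerCost hβ₀ hG (hb0.trans (hb (Fin.zero_le _))) (hb (Fin.castSucc_le_succ j))

/-- Ceiling ⟹ **`protocolCost F b ≤ K·Σ_j f(log(b_{j+1}/b_j))`**. [ours] -/
theorem protocolCost_le_mul_sum_layerCost {F : ℝ → ℝ} {K β₀ : ℝ} (hβ₀ : 0 < β₀)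
    (hG : ConcaveOn ℝ (Ici β₀) (fun β => F β + K * Real.log β)) (b : Fin (n + 1) → ℝ)
    (hb0 : β₀ ≤ b 0) (hb : Monotone b) :
    protocolCost F b ≤ K * ∑ j : Fin n, layerCost (Real.log (b j.succ / b j.castSucc)) := by
  rw [protocolCost, Finset.mul_sum]
  exact Finset.sum_le_sum fun j _ =>
    secondDiff_le_mul_layerCost hβ₀ hG (hb0.trans (hb (Fin.zero_le _))) (hb (Fin.castSucc_le_succ j))

/-- **THE `log² R` NECESSITY LAW (abstract form).**  If `F + K log` is convex on `[β₀, ∞)` with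
`K ≥ 0`, then for EVERY monotone protocol `β₀ ≤ b₀ ≤ … ≤ b_n` (`n ≥ 1`), with `U = log(b_n/b_0)`:
**`K·U²/(n + U) ≤ protocolCost F b`**. [ours] -/
theorem protocolCost_ge_sq_div {F : ℝ → ℝ} {K β₀ : ℝ} (hβ₀ : 0 < β₀) (hK : 0 ≤ K)
    (hG : ConvexOn ℝ (Ici β₀) (fun β => F β + K * Real.log β)) (hn : 0 < n) (b : Fin (n + 1) → ℝ)
    (hb0 : β₀ ≤ b 0) (hb : Monotone b) :
    K * (Real.log (b (Fin.last n) / b 0)) ^ 2 / (n + Real.log (b (Fin.last n) / b 0)) ≤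
      protocolCost F b := by
  have hpos : ∀ j, 0 < b j := fun j => lt_of_lt_of_le hβ₀ (hb0.trans (hb (Fin.zero_le _)))
  have hu : ∀ j : Fin n, 0 ≤ Real.log (b j.succ / b j.castSucc) := fun j =>
    Real.log_nonneg ((one_le_div (hpos _)).2 (hb (Fin.castSucc_le_succ j)))
  have h1 := sum_layerCost_ge_sq_div hn (fun j : Fin n => Real.log (b j.succ / b j.castSucc)) hu
  rw [sum_log_ratio_eq b hpos] at h1
  have h2 := protocolCost_ge_mul_sum_layerCost hβ₀ hG b hb0 hb
  calc K * (Real.log (b (Fin.last n) / b 0)) ^ 2 / (n + Real.log (b (Fin.last n) / b 0))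
      = K * ((Real.log (b (Fin.last n) / b 0)) ^ 2 / (n + Real.log (b (Fin.last n) / b 0))) := by
        ring
    _ ≤ K * ∑ j : Fin n, layerCost (Real.log (b j.succ / b j.castSucc)) :=
        mul_le_mul_of_nonneg_left h1 hK
    _ ≤ protocolCost F b := h2

/-- **LAYERS NECESSARY.**  Under the floor, a protocol from `b_0` to `b_n = R·b_0` inside `[β₀, ∞)` whose
cost is `≤ t` has **`n ≥ K·log²R/t − log R`** layers. [ours] -/
theorem layers_necessary {F : ℝ → ℝ} {K β₀ t : ℝ} (hβ₀ : 0 < β₀) (hK : 0 ≤ K)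
    (hG : ConvexOn ℝ (Ici β₀) (fun β => F β + K * Real.log β)) (hn : 0 < n) (b : Fin (n + 1) → ℝ)
    (hb0 : β₀ ≤ b 0) (hb : Monotone b) (ht : 0 < t) (hcost : protocolCost F b ≤ t) :
    K * (Real.log (b (Fin.last n) / b 0)) ^ 2 / t - Real.log (b (Fin.last n) / b 0) ≤ n := by
  have hpos0 : 0 < b 0 := lt_of_lt_of_le hβ₀ hb0
  have hU : 0 ≤ Real.log (b (Fin.last n) / b 0) :=
    Real.log_nonneg ((one_le_div hpos0).2 (hb (Fin.zero_le _)))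
  have hn' : (0 : ℝ) < n := by exact_mod_cast hn
  have h := (protocolCost_ge_sq_div hβ₀ hK hG hn b hb0 hb).trans hcost
  rw [div_le_iff₀ (by linarith : (0 : ℝ) < n + Real.log (b (Fin.last n) / b 0))] at h
  rw [sub_le_iff_le_add, div_le_iff₀ ht]
  linarith

/-- `u²/(1+u) ≤ s` with `u, s ≥ 0` forces `u ≤ s + √s`. [folklore] -/
theorem le_add_sqrt_of_sq_div_le {u s : ℝ} (hu : 0 ≤ u) (hs : 0 ≤ s) (h : u ^ 2 / (1 + u) ≤ s) :
    u ≤ s + Real.sqrt s := by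
  have h1 : u ^ 2 ≤ s * (1 + u) := by rwa [div_le_iff₀ (by linarith)] at h
  rcases le_or_gt u (s + Real.sqrt s) with hle | hlt
  · exact hle
  · exfalso
    have hr0 : 0 ≤ Real.sqrt s := Real.sqrt_nonneg s
    have hr : Real.sqrt s ^ 2 = s := Real.sq_sqrt hs
    have hu0 : 0 < u := lt_of_le_of_lt (by positivity) hlt
    nlinarith [mul_nonneg hr0 (sub_pos.2 hlt).le, mul_pos hu0 (sub_pos.2 hlt), mul_nonneg hs hr0]

/-- **PER-STEP WINDOW LAW (the `√K·log R` law).**  Under the floor with `K > 0`, if EVERY step of the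
protocol costs `≤ t₀` (each step's weight has second moment `≤ e^{t₀}`: an `O(1)` reweighting window per
step), then with `s = t₀/K`: **`log R ≤ n·(s + √s)`**, i.e. `n ≥ log R/(s + √s) ≥ (log R/2)·√(K/t₀)` for
`t₀ ≤ K` — the number of `O(1)`-overlap steps across a coupling RATIO `R` is at least `½√(K/t₀)·log R`
(`K = c·V`: the printed `√V` replica-count law of replica exchange / reweighting windows with its
`log R` made explicit, Nymeyer–Gnanakaran–García 2004 eqs. (10)–(12); Kofke 2002). [ours] -/
theorem logRatio_le_of_stepCost {F : ℝ → ℝ} {K β₀ t₀ : ℝ} (hβ₀ : 0 < β₀) (hK : 0 < K)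
    (hG : ConvexOn ℝ (Ici β₀) (fun β => F β + K * Real.log β)) (b : Fin (n + 1) → ℝ)
    (hb0 : β₀ ≤ b 0) (hb : Monotone b) (ht : 0 ≤ t₀)
    (hstep : ∀ j : Fin n, F (b j.castSucc) + F (2 * b j.succ - b j.castSucc) - 2 * F (b j.succ) ≤ t₀) :
    Real.log (b (Fin.last n) / b 0) ≤ n * (t₀ / K + Real.sqrt (t₀ / K)) := by
  have hpos : ∀ j, 0 < b j := fun j => lt_of_lt_of_le hβ₀ (hb0.trans (hb (Fin.zero_le _)))
  have hu : ∀ j : Fin n, 0 ≤ Real.log (b j.succ / b j.castSucc) := fun j =>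
    Real.log_nonneg ((one_le_div (hpos _)).2 (hb (Fin.castSucc_le_succ j)))
  have hstep' : ∀ j : Fin n, Real.log (b j.succ / b j.castSucc) ≤ t₀ / K + Real.sqrt (t₀ / K) := by
    intro j
    refine le_add_sqrt_of_sq_div_le (hu j) (div_nonneg ht hK.le) ?_
    have h1 := layerCost_ge_sq_div (hu j)
    have h2 := secondDiff_ge_mul_layerCost hβ₀ hG (hb0.trans (hb (Fin.zero_le _)))
      (hb (Fin.castSucc_le_succ j))
    rw [le_div_iff₀ hK]
    nlinarith [hstep j, mul_le_mul_of_nonneg_left h1 hK.le]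
  rw [← sum_log_ratio_eq b hpos]
  refine (Finset.sum_le_sum fun j _ => hstep' j).trans ?_
  rw [Finset.sum_const, Finset.card_univ, Fintype.card_fin, nsmul_eq_mul]

/-- Ceiling with `K ≥ 0` ⟹ **`protocolCost F b ≤ K·Σ_j log²(b_{j+1}/b_j)`** (tree `layerCost_le_sq`).
[ours] -/
theorem protocolCost_le_mul_sum_sq {F : ℝ → ℝ} {K β₀ : ℝ} (hβ₀ : 0 < β₀) (hK : 0 ≤ K)
    (hG : ConcaveOn ℝ (Ici β₀) (fun β => F β + K * Real.log β)) (b : Fin (n + 1) → ℝ)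
    (hb0 : β₀ ≤ b 0) (hb : Monotone b) :
    protocolCost F b ≤ K * ∑ j : Fin n, (Real.log (b j.succ / b j.castSucc)) ^ 2 := by
  have hpos : ∀ j, 0 < b j := fun j => lt_of_lt_of_le hβ₀ (hb0.trans (hb (Fin.zero_le _)))
  have hu : ∀ j : Fin n, 0 ≤ Real.log (b j.succ / b j.castSucc) := fun j =>
    Real.log_nonneg ((one_le_div (hpos _)).2 (hb (Fin.castSucc_le_succ j)))
  refine (protocolCost_le_mul_sum_layerCost hβ₀ hG b hb0 hb).trans
    (mul_le_mul_of_nonneg_left (Finset.sum_le_sum fun j _ => layerCost_le_sq (hu j)) hK)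

/-- **The geometric protocol** `b_j = β₀·e^{jU/n}` (`j = 0, …, n`): equal coupling RATIOS `e^{U/n}`, from
`β₀` to `R·β₀`, `R = e^U`. [folklore] -/
def geomProtocol (β₀ U : ℝ) (n : ℕ) : Fin (n + 1) → ℝ := fun j => β₀ * Real.exp (U * j / n)

/-- The geometric protocol starts at `β₀`. [folklore] -/
theorem geomProtocol_zero (β₀ U : ℝ) (n : ℕ) : geomProtocol β₀ U n 0 = β₀ := by
  simp [geomProtocol]

/-- The geometric protocol ends at `β₀ e^U` (`n ≥ 1`). [folklore] -/
theorem geomProtocol_last (β₀ U : ℝ) (hn : 0 < n) :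
    geomProtocol β₀ U n (Fin.last n) = β₀ * Real.exp U := by
  have hn' : (n : ℝ) ≠ 0 := by exact_mod_cast hn.ne'
  simp [geomProtocol, hn']

/-- The geometric protocol is monotone for `β₀, U ≥ 0`. [folklore] -/
theorem geomProtocol_monotone {β₀ U : ℝ} (hβ₀ : 0 ≤ β₀) (hU : 0 ≤ U) (n : ℕ) :
    Monotone (geomProtocol β₀ U n) := by
  intro i j hij
  simp only [geomProtocol]
  refine mul_le_mul_of_nonneg_left (Real.exp_le_exp.2 ?_) hβ₀
  have hij' : ((i : ℕ) : ℝ) ≤ ((j : ℕ) : ℝ) := by exact_mod_cast hij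
  exact div_le_div_of_nonneg_right (mul_le_mul_of_nonneg_left hij' hU) (Nat.cast_nonneg n)

/-- Each layer of the geometric protocol has log-ratio `U/n`. [folklore] -/
theorem log_geomProtocol_ratio {β₀ : ℝ} (hβ₀ : 0 < β₀) (U : ℝ) (hn : 0 < n) (j : Fin n) :
    Real.log (geomProtocol β₀ U n j.succ / geomProtocol β₀ U n j.castSucc) = U / n := by
  simp only [geomProtocol, Fin.val_succ, Fin.val_castSucc, Nat.cast_add, Nat.cast_one]
  rw [mul_div_mul_left _ _ hβ₀.ne', ← Real.exp_sub, Real.log_exp]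
  have hn' : (n : ℝ) ≠ 0 := by exact_mod_cast hn.ne'
  field_simp
  ring

/-- **THE `log² R` SUFFICIENCY LAW (abstract form).**  If `F + K log` is concave on `[β₀, ∞)` with
`K ≥ 0`, the geometric protocol with `n ≥ 1` layers from `β₀` to `e^U β₀` (`U ≥ 0`) costs
**`protocolCost F b ≤ K·U²/n`**. [ours] -/
theorem protocolCost_geomProtocol_le {F : ℝ → ℝ} {K β₀ U : ℝ} (hβ₀ : 0 < β₀) (hK : 0 ≤ K)
    (hU : 0 ≤ U) (hG : ConcaveOn ℝ (Ici β₀) (fun β => F β + K * Real.log β)) (hn : 0 < n) :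
    protocolCost F (geomProtocol β₀ U n) ≤ K * U ^ 2 / n := by
  have hb0 : β₀ ≤ geomProtocol β₀ U n 0 := by rw [geomProtocol_zero]
  have h := protocolCost_le_mul_sum_layerCost hβ₀ hG _ hb0 (geomProtocol_monotone hβ₀.le hU n)
  simp only [log_geomProtocol_ratio hβ₀ U hn, Finset.sum_const, Finset.card_univ, Fintype.card_fin,
    nsmul_eq_mul] at h
  calc protocolCost F (geomProtocol β₀ U n) ≤ K * (n * layerCost (U / n)) := h
    _ ≤ K * (U ^ 2 / n) := mul_le_mul_of_nonneg_left (geometric_cost_le hn hU) hK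
    _ = K * U ^ 2 / n := by ring

/-- **LAYERS SUFFICIENT.**  Under the ceiling, `n ≥ K·U²/t` geometric layers cost `≤ t`. [ours] -/
theorem geomProtocol_layers_sufficient {F : ℝ → ℝ} {K β₀ U t : ℝ} (hβ₀ : 0 < β₀) (hK : 0 ≤ K)
    (hU : 0 ≤ U) (hG : ConcaveOn ℝ (Ici β₀) (fun β => F β + K * Real.log β)) (hn : 0 < n)
    (ht : 0 < t) (hnt : K * U ^ 2 / t ≤ n) :
    protocolCost F (geomProtocol β₀ U n) ≤ t := by
  have hn' : (0 : ℝ) < n := by exact_mod_cast hn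
  refine (protocolCost_geomProtocol_le hβ₀ hK hU hG hn).trans ?_
  rw [div_le_iff₀ hn']
  rw [div_le_iff₀ ht] at hnt
  linarith

end Protocol

end Summit.Ventures.LatticeQCDFlow.Theory2.SpecificHeat
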